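import Mathlib
import HarnessLib
import Summits.HubbardSuperconductivity.HubbardSuperconductivity.Theorems.KLProgrammeKLRegimeEnginePairTransferMemberSplit3
import Summits.HubbardSuperconductivity.HubbardSuperconductivity.Theorems.KLProgrammeKLRegimeEnginePairTransferMemberRates

/-!
# Route `KLProgramme` — ENGINE item stmt-HubbardSuperconductivity-20437 `KLRegimeEngineV17F2`, row (c) OUT-of-class package θ (`rowC_hexOut_of_pkgθ`,
# …EngineV17F2ClosersVGQOutT, PIN v11 slot (c)), binder row `hLr` = the frequency-LOCALISATION remainder `RL` (located #17 «(c)-OUT-RL-SHARE», cure (δ′)):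
# PRODUCER-SIDE BRICK 1/2 — the pp slice-bubble RATE kernel `Br` POINTWISE: size and SUPPORT (frequency band, bare ball)
# (cell gate-hubbard-kl, seat hubbard-kl-k3c2-p2 g29, technique «thermal-bar induction n ≤ nScales β + 1 with EngineBoundsAtV4S sums»)

WHY.  Package θ asks the E1 producer for ONE number `RL` with
`hLr : ∀ t ∈ [0,1], ‖Σ_{z : 𝕋_L × Mats} Br j Qm t z · (𝟙[z.1 ∈ klBall L μ 0]·V(ω₀-pinned legs; z.1)·V(ω₀-pinned; z.1) − V((z.2,z.1)-resolved)·V(resolved))‖ ≤ RL`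
and books it in the joint envelope `hShareEpsL` next to the (ε)(W) charges of the direct term.  Here
`Br j Qm t z = −(βL²)⁻¹·ĝ_K(z.2,z.1)·ĝ_K(z.2ʳ,Qm−z.1)·(Λₙ₊₁−Λₙ)·(−Ẇ_t(z.2,z.1)·Φ_j(t)(z.2ʳ,Qm−z.1) − Φ_j(t)(z.2,z.1)·Ẇ_t(z.2ʳ,Qm−z.1))` is the pp one-loop RATE kernel at
pair momentum `Qm` along slice `n+1` (one HARD line on the cutoff-derivative shell of `Λ(t) = Λₙ + t(Λₙ₊₁−Λₙ)`, one SOFT line on the running member symbol `Φ_j(t)`,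
`j ≥ n+1`).  LOCATED-C-OUT-RL-SHARE §3: the natural derivation of `RL` is «the pp-arranged twin of the (P)(W)(ε) moduli (same windows), no new KIND of E1 statement»;
this file and its sequel (…PPRateWindow: total / WINDOW mass and the reduction of `hLr` to off/on-window moduli) make that literal.  For the VERBATIM `Φ / Wd / Br`
lambdas of θ (generic frame `K`; θ has `K = klFlowFrameU L M β U μ n`):
* `klpr_norm_rate_le` — `‖Br z‖ ≤ (βL²)⁻¹(Λₙ−Λₙ₊₁)·((128/3)/Λ(t)²)·(|Φ(z′)|‖ĝ z′‖ + |Φ(z)|‖ĝ z‖)`, `z′ = (z.2ʳ, Qm − z.1)` (hard line `abs_derivWeight_mul_norm_propCT_le`,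
  both orders of the product);
* `klpr_rate_eq_zero_of_sq_lt` / `klpr_sq_le_of_rate_ne_zero` — FREQUENCY SUPPORT: `Br z ≠ 0 ⇒ ω_{z.2}² ≤ Λ(t)² ≤ (4Λₙ₊₁)²` (both terms carry a `Ẇ` factor at `±ω_{z.2}`;
  this is the band of θ's modulus rows);
* `klpr_rate_eq_zero_of_not_mem_ball` / `klpr_mem_ball_of_rate_ne_zero` — BALL SUPPORT: on a frame with `|K(p_k⃗)| ≤ A` on the torus and `Λₙ + A ≤ e₀`:
  `Br z ≠ 0 ⇒ z.1 ∈ klBall L μ 0` (the `Ẇ` resp. `Φ` factor at `(z.2, z.1)` forces `|e_K(z.1)| ≤ Λₙ`, hence `|ξ(z.1)| ≤ Λₙ + A ≤ e₀`); `A = 2·Gfr₀·|U|` from `FrameOK` alone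
  (`klld_abs_eval_latticeMomentum_le_of_frameOK`) or θ's `A` of `hAb` (`abs_frameShift_toLp_le`); `klpr_klScale_add_le_klE0` — `1 ≤ n`, `4A ≤ 1/20 ⇒ Λₙ + A ≤ e₀` (θ's `hA20`).
So on the support of `Br` the ball indicator of `hLr` is `1` and the bracket is a pure frequency-localisation difference.  Real analysis over landed rows; nothing about the
effective action is asserted; nothing asserts (c), K3 or superconductivity.  0 kit · 0 lit.
-/
noncomputable section

namespace Summit.HubbardSuperconductivity.HubbardSuperconductivity.Theorems.KLRegimeSplit

set_option linter.dupNamespace false -- summit = problem name (single-conjunct summit), D-0017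

open Real Set Finset Complex Literature.MathematicalPhysics.QuantumLattice
open Literature.Probability.LatticeModels hiding torusSupNorm
open Summit.HubbardSuperconductivity.HubbardSuperconductivity.Theorems.KLProgrammeLegKernels
open Summit.HubbardSuperconductivity.HubbardSuperconductivity.Theorems.KLRegimeWick
open Summit.HubbardSuperconductivity.HubbardSuperconductivity.Theorems.TwoPointAssembly
open Summit.HubbardSuperconductivity.HubbardSuperconductivity.Theorems.DispersionFlow
open Summit.HubbardSuperconductivity.HubbardSuperconductivity.Theorems.EngineV8

variable {L M : ℕ} [NeZero L] (β μ : ℝ) (K : TrigPolyC4v)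

/-! ## §1 The rate kernel pointwise: size and support -/

section Pointwise

omit [NeZero L] in
/-- `|−a·b − c·d| ≤ |a|·|b| + |c|·|d|`. -/
private theorem abs_neg_mul_sub_mul_le (a b c d : ℝ) : |-a * b - c * d| ≤ |a| * |b| + |c| * |d| := by
  rw [show -a * b - c * d = -(a * b + c * d) by ring, abs_neg]
  exact (abs_add_le _ _).trans (by rw [abs_mul, abs_mul])

/-- **The pp rate kernel, pointwise**: with `Λ(t) = Λₙ + t(Λₙ₊₁ − Λₙ)`, `t ∈ [0,1]`, `0 < β`:
`‖Br j Qm t z‖ ≤ (βL²)⁻¹·((Λₙ − Λₙ₊₁)·(128/3)/Λ(t)²)·(|Φ_j(t)(z′)|·‖ĝ_K(z′)‖ + |Φ_j(t)(z.2,z.1)|·‖ĝ_K(z.2,z.1)‖)`, `z′ = (z.2ʳ, Qm − z.1)` — each of the two terms has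
one HARD derivative line (`abs_derivWeight_mul_norm_propCT_le`: `|Ẇ_{Λ(t)}|‖ĝ_K‖ ≤ (128/3)/Λ(t)²`) and one soft line. -/
theorem klpr_norm_rate_le (hβ : 0 < β) (n : ℕ) {t : ℝ} (ht : t ∈ Icc (0 : ℝ) 1)
    (Φ : ℕ → ℝ → FreqMomentum L M → ℝ)
    (Wd : ℝ → FreqMomentum L M → ℝ)
    (hWd : Wd = fun t k => deriv (fun Λ' : ℝ => hubbardCutoffWeightCT L M β μ K Λ' k) (klScale klE0 n + t * (klScale klE0 (n + 1) - klScale klE0 n)))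
    (Br : ℕ → TorusSite 2 L → ℝ → TorusSite 2 L × MatsubaraIdx M → ℂ)
    (hBr : Br = fun j Qm t z => -(((((β * (L : ℝ) ^ 2 : ℝ) : ℂ)))⁻¹ * propCT L M β μ K (z.2, z.1) * propCT L M β μ K (z.2.rev, Qm - z.1)) *
      ((((klScale klE0 (n + 1) - klScale klE0 n) * (-Wd t (z.2, z.1) * Φ j t (z.2.rev, Qm - z.1) - Φ j t (z.2, z.1) * Wd t (z.2.rev, Qm - z.1))) : ℝ) : ℂ))
    (j : ℕ) (Qm : TorusSite 2 L) (z : TorusSite 2 L × MatsubaraIdx M) :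
    ‖Br j Qm t z‖ ≤ (β * (L : ℝ) ^ 2)⁻¹ * ((klScale klE0 n - klScale klE0 (n + 1)) * (128 / 3 / (klScale klE0 n + t * (klScale klE0 (n + 1) - klScale klE0 n)) ^ 2)) *
      (|Φ j t (z.2.rev, Qm - z.1)| * ‖propCT L M β μ K (z.2.rev, Qm - z.1)‖ + |Φ j t (z.2, z.1)| * ‖propCT L M β μ K (z.2, z.1)‖) := by
  have hL : (0 : ℝ) < L := Nat.cast_pos.2 (Nat.pos_of_ne_zero (NeZero.ne L))
  have hβL2 : 0 < β * (L : ℝ) ^ 2 := by positivity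
  have h10 := (klmf_klScale_succ_pos_le n).2
  have h1 := (klmf_klScale_succ_pos_le n).1
  set Λt : ℝ := klScale klE0 n + t * (klScale klE0 (n + 1) - klScale klE0 n) with hΛt_def
  have hmem : Λt ∈ Icc (klScale klE0 (n + 1)) (klScale klE0 n) := klws_affine_mem_Icc h10 ht
  have hΛt : 0 < Λt := h1.trans_le hmem.1
  set g₁ : ℂ := propCT L M β μ K (z.2, z.1) with hg₁
  set g₂ : ℂ := propCT L M β μ K (z.2.rev, Qm - z.1) with hg₂
  -- the two hard-line bounds
  have hD₁ : |Wd t (z.2, z.1)| * ‖g₁‖ ≤ 128 / 3 / Λt ^ 2 := by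
    rw [hWd]; exact abs_derivWeight_mul_norm_propCT_le β μ K hΛt (z.2, z.1)
  have hD₂ : |Wd t (z.2.rev, Qm - z.1)| * ‖g₂‖ ≤ 128 / 3 / Λt ^ 2 := by
    rw [hWd]; exact abs_derivWeight_mul_norm_propCT_le β μ K hΛt (z.2.rev, Qm - z.1)
  -- the norm of the kernel entry
  have hnorm : ‖Br j Qm t z‖ = (β * (L : ℝ) ^ 2)⁻¹ * (klScale klE0 n - klScale klE0 (n + 1)) *
      (‖g₁‖ * ‖g₂‖ * |-Wd t (z.2, z.1) * Φ j t (z.2.rev, Qm - z.1) - Φ j t (z.2, z.1) * Wd t (z.2.rev, Qm - z.1)|) := by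
    simp only [hBr]
    rw [norm_mul, norm_neg, norm_mul, norm_mul, norm_inv, Complex.norm_real, Complex.norm_real, Real.norm_eq_abs, Real.norm_eq_abs,
      abs_of_pos hβL2, abs_mul, abs_of_nonpos (by linarith [hmem.1, hmem.2]), neg_sub]
    ring
  have key : ‖g₁‖ * ‖g₂‖ * |-Wd t (z.2, z.1) * Φ j t (z.2.rev, Qm - z.1) - Φ j t (z.2, z.1) * Wd t (z.2.rev, Qm - z.1)| ≤
      128 / 3 / Λt ^ 2 * (|Φ j t (z.2.rev, Qm - z.1)| * ‖g₂‖ + |Φ j t (z.2, z.1)| * ‖g₁‖) := by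
    calc ‖g₁‖ * ‖g₂‖ * |-Wd t (z.2, z.1) * Φ j t (z.2.rev, Qm - z.1) - Φ j t (z.2, z.1) * Wd t (z.2.rev, Qm - z.1)|
        ≤ ‖g₁‖ * ‖g₂‖ * (|Wd t (z.2, z.1)| * |Φ j t (z.2.rev, Qm - z.1)| + |Φ j t (z.2, z.1)| * |Wd t (z.2.rev, Qm - z.1)|) :=
          mul_le_mul_of_nonneg_left (abs_neg_mul_sub_mul_le _ _ _ _) (by positivity)
      _ = (|Wd t (z.2, z.1)| * ‖g₁‖) * (|Φ j t (z.2.rev, Qm - z.1)| * ‖g₂‖) + (|Wd t (z.2.rev, Qm - z.1)| * ‖g₂‖) * (|Φ j t (z.2, z.1)| * ‖g₁‖) := by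
          ring
      _ ≤ 128 / 3 / Λt ^ 2 * (|Φ j t (z.2.rev, Qm - z.1)| * ‖g₂‖) + 128 / 3 / Λt ^ 2 * (|Φ j t (z.2, z.1)| * ‖g₁‖) :=
          add_le_add (mul_le_mul_of_nonneg_right hD₁ (by positivity)) (mul_le_mul_of_nonneg_right hD₂ (by positivity))
      _ = 128 / 3 / Λt ^ 2 * (|Φ j t (z.2.rev, Qm - z.1)| * ‖g₂‖ + |Φ j t (z.2, z.1)| * ‖g₁‖) := by ring
  have hdiff : 0 ≤ klScale klE0 n - klScale klE0 (n + 1) := by linarith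
  rw [hnorm]
  calc (β * (L : ℝ) ^ 2)⁻¹ * (klScale klE0 n - klScale klE0 (n + 1)) *
        (‖g₁‖ * ‖g₂‖ * |-Wd t (z.2, z.1) * Φ j t (z.2.rev, Qm - z.1) - Φ j t (z.2, z.1) * Wd t (z.2.rev, Qm - z.1)|)
      ≤ (β * (L : ℝ) ^ 2)⁻¹ * (klScale klE0 n - klScale klE0 (n + 1)) *
          (128 / 3 / Λt ^ 2 * (|Φ j t (z.2.rev, Qm - z.1)| * ‖g₂‖ + |Φ j t (z.2, z.1)| * ‖g₁‖)) :=
        mul_le_mul_of_nonneg_left key (by positivity)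
    _ = _ := by ring

omit [NeZero L] in
/-- **Frequency support of the rate kernel**: `Λ(t)² < ω_{z.2}²` ⇒ `Br j Qm t z = 0` — both terms carry a cutoff-derivative factor at frequency `±ω_{z.2}`, and
`Ẇ_{Λ(t)}(k) = 0` off the shell `Λ(t)²/4 ≤ ω² + e_K² ≤ Λ(t)²` (`klws_deriv_cutoffWeight_scale_eq_zero`). -/
theorem klpr_rate_eq_zero_of_sq_lt (n : ℕ) {t : ℝ} (ht : t ∈ Icc (0 : ℝ) 1)
    (Φ : ℕ → ℝ → FreqMomentum L M → ℝ)
    (Wd : ℝ → FreqMomentum L M → ℝ)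
    (hWd : Wd = fun t k => deriv (fun Λ' : ℝ => hubbardCutoffWeightCT L M β μ K Λ' k) (klScale klE0 n + t * (klScale klE0 (n + 1) - klScale klE0 n)))
    (Br : ℕ → TorusSite 2 L → ℝ → TorusSite 2 L × MatsubaraIdx M → ℂ)
    (hBr : Br = fun j Qm t z => -(((((β * (L : ℝ) ^ 2 : ℝ) : ℂ)))⁻¹ * propCT L M β μ K (z.2, z.1) * propCT L M β μ K (z.2.rev, Qm - z.1)) *
      ((((klScale klE0 (n + 1) - klScale klE0 n) * (-Wd t (z.2, z.1) * Φ j t (z.2.rev, Qm - z.1) - Φ j t (z.2, z.1) * Wd t (z.2.rev, Qm - z.1))) : ℝ) : ℂ))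
    (j : ℕ) (Qm : TorusSite 2 L) {z : TorusSite 2 L × MatsubaraIdx M}
    (hz : (klScale klE0 n + t * (klScale klE0 (n + 1) - klScale klE0 n)) ^ 2 < matsubaraFreq β M z.2 ^ 2) : Br j Qm t z = 0 := by
  have h10 := (klmf_klScale_succ_pos_le n).2
  have h1 := (klmf_klScale_succ_pos_le n).1
  set Λt : ℝ := klScale klE0 n + t * (klScale klE0 (n + 1) - klScale klE0 n) with hΛt_def
  have hmem : Λt ∈ Icc (klScale klE0 (n + 1)) (klScale klE0 n) := klws_affine_mem_Icc h10 ht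
  have hΛt : 0 < Λt := h1.trans_le hmem.1
  have hW₁ : Wd t (z.2, z.1) = 0 := by
    rw [hWd]
    exact klws_deriv_cutoffWeight_scale_eq_zero L M β μ K hΛt.ne' (z.2, z.1) (Or.inr (by nlinarith [sq_nonneg (nambuXiCT L μ K z.1)]))
  have hW₂ : Wd t (z.2.rev, Qm - z.1) = 0 := by
    rw [hWd]
    refine klws_deriv_cutoffWeight_scale_eq_zero L M β μ K hΛt.ne' (z.2.rev, Qm - z.1) (Or.inr ?_)
    have hrev : matsubaraFreq β M (Fin.rev z.2) ^ 2 = matsubaraFreq β M z.2 ^ 2 := by rw [matsubaraFreq_rev, neg_sq]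
    simp only
    rw [hrev]
    nlinarith [sq_nonneg (nambuXiCT L μ K (Qm - z.1))]
  simp only [hBr, hW₁, hW₂, neg_zero, zero_mul, mul_zero, sub_zero, Complex.ofReal_zero]

omit [NeZero L] in
/-- … contrapositive, in θ's currency: `Br j Qm t z ≠ 0 ⇒ ω_{z.2}² ≤ (4Λₙ₊₁)²` (`Λ(t) ≤ Λₙ = 4Λₙ₊₁`) — the frequency band of θ's modulus rows. -/
theorem klpr_sq_le_of_rate_ne_zero (n : ℕ) {t : ℝ} (ht : t ∈ Icc (0 : ℝ) 1)
    (Φ : ℕ → ℝ → FreqMomentum L M → ℝ)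
    (Wd : ℝ → FreqMomentum L M → ℝ)
    (hWd : Wd = fun t k => deriv (fun Λ' : ℝ => hubbardCutoffWeightCT L M β μ K Λ' k) (klScale klE0 n + t * (klScale klE0 (n + 1) - klScale klE0 n)))
    (Br : ℕ → TorusSite 2 L → ℝ → TorusSite 2 L × MatsubaraIdx M → ℂ)
    (hBr : Br = fun j Qm t z => -(((((β * (L : ℝ) ^ 2 : ℝ) : ℂ)))⁻¹ * propCT L M β μ K (z.2, z.1) * propCT L M β μ K (z.2.rev, Qm - z.1)) *
      ((((klScale klE0 (n + 1) - klScale klE0 n) * (-Wd t (z.2, z.1) * Φ j t (z.2.rev, Qm - z.1) - Φ j t (z.2, z.1) * Wd t (z.2.rev, Qm - z.1))) : ℝ) : ℂ))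
    (j : ℕ) (Qm : TorusSite 2 L) {z : TorusSite 2 L × MatsubaraIdx M} (hz : Br j Qm t z ≠ 0) :
    matsubaraFreq β M z.2 ^ 2 ≤ (4 * klScale klE0 (n + 1)) ^ 2 := by
  have h10 := (klmf_klScale_succ_pos_le n).2
  have hmem := klws_affine_mem_Icc h10 ht
  have hsucc : klScale klE0 (n + 1) = klScale klE0 n / 4 := klth_klScale_succ n
  by_contra hlt
  push Not at hlt
  refine hz (klpr_rate_eq_zero_of_sq_lt β μ K n ht Φ Wd hWd Br hBr j Qm ?_)
  have h4 : 4 * klScale klE0 (n + 1) = klScale klE0 n := by rw [hsucc]; ring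
  rw [h4] at hlt
  have h0 : 0 ≤ klScale klE0 n + t * (klScale klE0 (n + 1) - klScale klE0 n) := (klmf_klScale_succ_pos_le n).1.le.trans hmem.1
  exact lt_of_le_of_lt (pow_le_pow_left₀ h0 hmem.2 2) hlt

/-- **Ball support of the rate kernel**: on a frame with `|K(p_k⃗)| ≤ A` on the torus and `Λₙ + A ≤ e₀`, for the running member symbol `Φ_j(t)` (`n+1 ≤ j`):
`z.1 ∉ klBall L μ 0 ⇒ Br j Qm t z = 0` — there `|e_K(z.1)| ≥ |ξ(z.1)| − |K| > e₀ − A ≥ Λₙ ≥ Λ(t)`, so the `Ẇ` factor at `(z.2, z.1)` vanishes (off the shell) and the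
`Φ` factor at `(z.2, z.1)` vanishes (`0 ≤ Φ ≤ 1 − w^K_{Λₙ} = 0` above scale `n`, `klmf_runningSymbol_mem` + `hubbardCutoffWeightCT_eq_one_of_sq_le`). -/
theorem klpr_rate_eq_zero_of_not_mem_ball (n : ℕ) {t : ℝ} (ht : t ∈ Icc (0 : ℝ) 1) {A : ℝ}
    (hKA : ∀ k : TorusSite 2 L, |K.eval (latticeMomentum L k)| ≤ A) (hA : klScale klE0 n + A ≤ klE0)
    (Φ : ℕ → ℝ → FreqMomentum L M → ℝ)
    (hΦ : Φ = fun j t k => (softSymbolCompl L M β μ K (n + 1) j) k + (hubbardCutoffWeightCT L M β μ K (klScale klE0 (n + 1)) k -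
        hubbardCutoffWeightCT L M β μ K (klScale klE0 n + t * (klScale klE0 (n + 1) - klScale klE0 n)) k))
    (Wd : ℝ → FreqMomentum L M → ℝ)
    (hWd : Wd = fun t k => deriv (fun Λ' : ℝ => hubbardCutoffWeightCT L M β μ K Λ' k) (klScale klE0 n + t * (klScale klE0 (n + 1) - klScale klE0 n)))
    (Br : ℕ → TorusSite 2 L → ℝ → TorusSite 2 L × MatsubaraIdx M → ℂ)
    (hBr : Br = fun j Qm t z => -(((((β * (L : ℝ) ^ 2 : ℝ) : ℂ)))⁻¹ * propCT L M β μ K (z.2, z.1) * propCT L M β μ K (z.2.rev, Qm - z.1)) *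
      ((((klScale klE0 (n + 1) - klScale klE0 n) * (-Wd t (z.2, z.1) * Φ j t (z.2.rev, Qm - z.1) - Φ j t (z.2, z.1) * Wd t (z.2.rev, Qm - z.1))) : ℝ) : ℂ))
    {j : ℕ} (hj : n + 1 ≤ j) (Qm : TorusSite 2 L) {z : TorusSite 2 L × MatsubaraIdx M} (hz : z.1 ∉ klBall L μ 0) :
    Br j Qm t z = 0 := by
  have h10 := (klmf_klScale_succ_pos_le n).2
  have h1 := (klmf_klScale_succ_pos_le n).1
  have hΛn : 0 < klScale klE0 n := klth_klScale_pos n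
  set Λt : ℝ := klScale klE0 n + t * (klScale klE0 (n + 1) - klScale klE0 n) with hΛt_def
  have hmem : Λt ∈ Icc (klScale klE0 (n + 1)) (klScale klE0 n) := klws_affine_mem_Icc h10 ht
  have hΛt : 0 < Λt := h1.trans_le hmem.1
  -- off the bare ball the frame level exceeds `Λₙ`
  have hξ : klE0 < |nambuXi L μ z.1| := by
    have h : ¬ |nambuXi L μ z.1| ≤ klScale klE0 0 := by
      rwa [klBall, klShell, mem_momentumShell, nambuXiCT_zero_frame] at hz
    rw [klScale, pow_zero, inv_one, mul_one] at h
    exact lt_of_not_ge h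
  have he : klScale klE0 n < |nambuXiCT L μ K z.1| := by
    have hsum : |nambuXi L μ z.1| ≤ |nambuXiCT L μ K z.1| + |K.eval (latticeMomentum L z.1)| := by
      rw [nambuXi_eq_nambuXiCT_add L μ K]; exact abs_add_le _ _
    linarith [hKA z.1]
  have hsq : klScale klE0 n ^ 2 < nambuXiCT L μ K z.1 ^ 2 := by
    rw [← sq_abs (nambuXiCT L μ K z.1)]
    exact pow_lt_pow_left₀ he hΛn.le two_ne_zero
  have hsqt : Λt ^ 2 < matsubaraFreq β M z.2 ^ 2 + nambuXiCT L μ K z.1 ^ 2 := by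
    have : Λt ^ 2 ≤ klScale klE0 n ^ 2 := pow_le_pow_left₀ hΛt.le hmem.2 2
    nlinarith [sq_nonneg (matsubaraFreq β M z.2)]
  -- the `Ẇ` factor at `(z.2, z.1)` vanishes
  have hW₁ : Wd t (z.2, z.1) = 0 := by
    rw [hWd]
    exact klws_deriv_cutoffWeight_scale_eq_zero L M β μ K hΛt.ne' (z.2, z.1) (Or.inr hsqt)
  -- the `Φ` factor at `(z.2, z.1)` vanishes
  have hΦ₁ : Φ j t (z.2, z.1) = 0 := by
    have hψ := (isSoftSymbol_compl (L := L) (M := M) β μ K hj).1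
    have hm := klmf_runningSymbol_mem L M β μ K n hψ ht (z.2, z.1)
    have hw1 : hubbardCutoffWeightCT L M β μ K (klScale klE0 n) (z.2, z.1) = 1 :=
      hubbardCutoffWeightCT_eq_one_of_sq_le β μ K hΛn (z.2, z.1) (by simp only; nlinarith [sq_nonneg (matsubaraFreq β M z.2)])
    rw [hw1, sub_self] at hm
    rw [hΦ]
    exact le_antisymm hm.2 hm.1
  simp only [hBr, hW₁, hΦ₁, neg_zero, zero_mul, mul_zero, sub_zero, Complex.ofReal_zero]

/-- … contrapositive: `Br j Qm t z ≠ 0 ⇒ z.1 ∈ klBall L μ 0`. -/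
theorem klpr_mem_ball_of_rate_ne_zero (n : ℕ) {t : ℝ} (ht : t ∈ Icc (0 : ℝ) 1) {A : ℝ}
    (hKA : ∀ k : TorusSite 2 L, |K.eval (latticeMomentum L k)| ≤ A) (hA : klScale klE0 n + A ≤ klE0)
    (Φ : ℕ → ℝ → FreqMomentum L M → ℝ)
    (hΦ : Φ = fun j t k => (softSymbolCompl L M β μ K (n + 1) j) k + (hubbardCutoffWeightCT L M β μ K (klScale klE0 (n + 1)) k -
        hubbardCutoffWeightCT L M β μ K (klScale klE0 n + t * (klScale klE0 (n + 1) - klScale klE0 n)) k))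
    (Wd : ℝ → FreqMomentum L M → ℝ)
    (hWd : Wd = fun t k => deriv (fun Λ' : ℝ => hubbardCutoffWeightCT L M β μ K Λ' k) (klScale klE0 n + t * (klScale klE0 (n + 1) - klScale klE0 n)))
    (Br : ℕ → TorusSite 2 L → ℝ → TorusSite 2 L × MatsubaraIdx M → ℂ)
    (hBr : Br = fun j Qm t z => -(((((β * (L : ℝ) ^ 2 : ℝ) : ℂ)))⁻¹ * propCT L M β μ K (z.2, z.1) * propCT L M β μ K (z.2.rev, Qm - z.1)) *
      ((((klScale klE0 (n + 1) - klScale klE0 n) * (-Wd t (z.2, z.1) * Φ j t (z.2.rev, Qm - z.1) - Φ j t (z.2, z.1) * Wd t (z.2.rev, Qm - z.1))) : ℝ) : ℂ))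
    {j : ℕ} (hj : n + 1 ≤ j) (Qm : TorusSite 2 L) {z : TorusSite 2 L × MatsubaraIdx M} (hz : Br j Qm t z ≠ 0) :
    z.1 ∈ klBall L μ 0 := by
  by_contra h
  exact hz (klpr_rate_eq_zero_of_not_mem_ball β μ K n ht hKA hA Φ hΦ Wd hWd Br hBr hj Qm h)

omit [NeZero L] in
/-- The smallness arithmetic of θ: `1 ≤ n`, `4A ≤ 1/20 ⇒ Λₙ + A ≤ e₀` (`Λₙ ≤ e₀/4 = 1/128`, `A ≤ 1/80`). -/
theorem klpr_klScale_add_le_klE0 {n : ℕ} (hn : 1 ≤ n) {A : ℝ} (hA20 : 4 * A ≤ 1 / 20) : klScale klE0 n + A ≤ klE0 := by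
  have h4 : (4 : ℝ) ≤ (4 : ℝ) ^ n := by
    calc (4 : ℝ) = (4 : ℝ) ^ 1 := (pow_one _).symm
      _ ≤ (4 : ℝ) ^ n := pow_le_pow_right₀ (by norm_num) hn
  have hinv : ((4 : ℝ) ^ n)⁻¹ ≤ (4 : ℝ)⁻¹ := inv_anti₀ (by norm_num) h4
  simp only [klScale, klE0]
  have h := mul_le_mul_of_nonneg_left hinv (by norm_num : (0 : ℝ) ≤ 1 / 32)
  linarith

end Pointwise

end Summit.HubbardSuperconductivity.HubbardSuperconductivity.Theorems.KLRegimeSplit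

end
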